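import Mathlib.NumberTheory.Zsqrtd.GaussianInt
import Mathlib.Tactic.IntervalCases
import Mathlib.Tactic.Linarith
import Mathlib.Tactic.Ring
import Mathlib.Tactic.LinearCombination
import Literature.NumberTheory.QuadraticFields.GaussianMinimalEuclideanRemainders
import HarnessLib

/-!
# A division algorithm for the minimal Euclidean function of `ℤ[i]` (Graves 2025, §§5–6, Theorem 1.5)

Topic `Literature/NumberTheory/QuadraticFields`, namespace `Literature.NumberTheory.QuadraticFields.GaussianDigits`.
THEOREMS ONLY (no `def`, no instance, no named fact); everything PROVED.  Second of two files formalising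
H. Graves, *A division algorithm for the Gaussian integers' minimal Euclidean function*, Canad. Math. Bull. **69**
(2025) 688–701 [Graves2025]; it uses the vocabulary of `GaussianMinimalEuclideanRemainders.lean` (`supNorm` = `ℓ∞`,
`oneNorm` = `ℓ1`, `minAbs` = `m`, `twoVal` = `v₂`, `normalUnit` = `u_z`, `imSign` = `s(r)`, `IsGaussRemainder`,
`InNormalCone`) and `digitSet n = B_n`, `width n = w_n`, `φ = motzkinNorm forall_exists_not_mem_motzkinSet`.

## Source (read at the page; materialised `paper:arxiv-2502.21136`, pp. 3, 5–10)

* THEOREM 1.5, VERBATIM: «Suppose `a, b ∈ ℤ[i] ∖ {0}` have Gauss quotient `q` and non-zero Gauss remainder `r`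
  with `φ_{ℤ[i]}(r) ≥ φ_{ℤ[i]}(b) = n`.  If any of the following conditions hold — `Im(u_b b) Im(u_r r) ≥ 0`;
  `m(r) + m(b) ≤ ℓ_∞(r)`; `m(b) < ℓ_∞(r) < m(b) + m(r)` and `ℓ_∞(b) − m(r) > w_{n−1} − 2^{v₂(b)+1}` — then
  `a = (q + u_b/u_r) b + (r − (u_b/u_r) b)`, with `φ(r − (u_b/u_r) b) < φ(b)`.  Otherwise,
  `a = (q + i u_b/(s(r) u_r)) b + (r − (i u_b/(s(r) u_r)) b)`, with `φ(r − (i u_b/(s(r) u_r)) b) < φ(b)`.»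
* §5.1: «if `φ(b) = n`, then `2^{v₂(b)} ≤ ℓ_∞(b) ≤ w_n − 2^{v₂(b)+1}` … `m(b) ≤ w_{n−1} − 2^{v₂(b)+1}`.»
  Lemma 5.1 (`ℓ_∞(b) − m(b) ≤ w_n − 3·2^{v₂(b)}`), Lemma 5.2 (`2^{v₂(r)} ∤ w_{n−1}` ⇒ `m(r) = 0` and the first
  alternative works), Lemma 5.3 (`2^{v₂(r)} ∣ w_{n−1}` ⇒ `ℓ_∞(r) = w_{n−1} − 2^{v₂(r)}` or
  `ℓ₁(r) ≥ w_n − 2^{v₂(r)+1}`; `ℓ_∞(r) ≥ w_n − w_{n−1}`, `ℓ₁(r) ≥ w_{n−1} − 2^{v₂(r)}`; `m(r) ≥ w_n − w_{n−1}`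
  unless `ℓ_∞(r) = w_{n−1} − 2^{v₂(r)}`), Corollary 5.4 (`m(r), ℓ_∞(r), ℓ_∞(b) − ℓ_∞(r) ≤ w_{n−1} − 2^{v₂(b)+1}`),
  Proposition 5.5 (condition (1) ⇒ first alternative), Lemma 6.1 (coordinates of `u_b b − u_r r` and
  `u_b b + s(r) i u_r r`), Lemmas 6.2 / 6.4 (second alternative when `m(b) ≥ ℓ_∞(r)`, resp.
  `m(b) < ℓ_∞(r) < m(b)+m(r)` and `ℓ_∞(b) − m(r) ≤ w_{n−1} − 2^{v₂(b)+1}`), Lemmas 6.3 / 6.5 (first alternative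
  under conditions (2), (3)), and the proof of Theorem 1.5 assembling them; Corollary 3.3 («if `φ(r) ≥ φ(b)` then
  `ℓ_∞(r) < ℓ₁(b)/2` and `ℓ₁(r) < ℓ_∞(b)`»).

## The reduction, and how the proofs are organised

`φ`, `ℓ∞`, `ℓ1`, `m`, `v₂` are invariant under units, and a Gauss remainder stays one under `b ↦ u_b b`,
`r ↦ u_r r` and under division of `b` and `r` by `2^{v₂(b)}` (Lemma 3.1; `2^{v₂(b)} ∣ r` by Lemma 4.1).  So
(`exists_reduction`) it suffices to treat `b = c + di`, `r = e + fi` in the normal cone (`u_b = u_r = 1`,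
`ℓ∞(b) = c`, `m(b) = |d|`, …) with `v₂(b) = 0`, `b ∈ B_{k+1}`, `r ∉ B_k` (`n = k+1`); then `r` is even,
`u_b b − u_r r = (c−e) + (d−f)i`, `u_b b + s(r) i u_r r = (c − |f|) + (d + s e) i`, and membership of these odd
Gaussian integers in `B_k` is membership in the octagon `Oct_k` ([Graves2023] Cor. 2.6).  `core_package` proves
Lemmas 5.1–5.4 in this form ONCE, with `K = 2^{⌊k/2⌋}` (`(w_k, w_{k+1}) = (3K, 4K)` or `(4K, 6K)`) and
`Q = 2^{v₂(r)}`, spelling out the divisibility gains («since `2^{v}` divides both …») as linear inequalities; the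
five target statements (Prop. 5.5, Lemmas 6.2–6.5) are then linear arithmetic (`omega`).  The printed forms of
Lemmas 5.1, 5.2, 5.3, Corollary 5.4 and Lemma 6.1 are derived separately.  Deviations: (i) Corollary 3.3 /
the strictness of Lemma 3.2 is not used (only the weak inequalities are needed; Corollary 3.3 is proved at the
end, via Lemma 4.1, parity and the exclusion of the double tie `r/b = (±1±i)/2`); (ii) in Lemma 6.2 the printed
bound `ℓ_∞(b) − m(r) ≤ w_n − 2^{v₂(b)+1} − (w_n − w_{n−1})` uses `m(r) ≥ w_n − w_{n−1}`, which Lemma 5.3 only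
gives when `ℓ_∞(r) ≠ w_{n−1} − 2^{v₂(r)}`; in the remaining case `ℓ_∞(b) ≤ 2w_{n−1} − 3·2^{v₂(b)} − m(b)
≤ w_{n−1} + 2^{v₂(r)} − 3·2^{v₂(b)}` and `m(r) ≥ 2^{v₂(r)}` give the same conclusion (this is inside the
`omega` certificate).  The printed statements were machine-checked beforehand for all `b` with
`|Re b|, |Im b| ≤ 48` (see the first file).

## Main statements

`core_package` (Lemmas 5.1–5.4), `re_sub_abs_im_le_width_of_inNormalCone` (5.1),
`im_eq_zero_of_not_pow_twoVal_dvd_width` (5.2), `supNorm_eq_or_le_oneNorm_of_pow_twoVal_dvd_width` (5.3),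
`le_width_sub_two_of_inNormalCone` (5.4), `sub_mem_digitSet_of_inNormalCone` (Prop. 5.5, Lemmas 6.3, 6.5),
`add_mem_digitSet_of_inNormalCone` (Lemmas 6.2, 6.4), `re_im_of_im_mul_im_neg` (Lemma 6.1), `exists_reduction`,
**`sub_unit_mul_mem_digitSet` / `sub_i_unit_mul_mem_digitSet`** (Theorem 1.5 for `B_n`),
**`eq_mul_add_of_gaussRemainder_of_cond` / `eq_mul_add_of_gaussRemainder_of_not_cond`** (Theorem 1.5 as printed,
for `φ`), `exists_explicit_remainder` (the algorithm run on Mathlib's `a / b`, `a % b`),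
`IsGaussRemainder.oneNorm_lt_supNorm` (Cor. 3.3), `section5_example` (`9 = (2−i)(4+i) + 2i`, `φ(2i) = φ(4+i) = 2`,
adjusted to `9 = 2(4+i) + (1−2i)`, `φ(1−2i) = 1`).
-/

namespace Literature.NumberTheory.QuadraticFields.GaussianDigits

open _root_.Zsqrtd Literature.Algebra.EuclideanDomain

/-! ## §8 The estimates of §§5–6 in reduced normal form

Throughout this section `b = c + di` and `r = e + fi` lie in the normal cone (`u_b = u_r = 1`), `v₂(b) = 0`,
`b ∈ B_{k+1}` (`φ(b) ≤ n := k+1`), `r ∉ B_k` (`φ(r) ≥ n`), and `r` is a Gauss remainder modulo `b`.  The general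
case is reduced to this one in §9 by the units `u_b`, `u_r` and the scaling `2^{v₂(b)}` (Lemma 3.1). -/

/-- **Lemmas 5.1–5.4 packaged** (reduced normal form).  With `K = 2^{⌊k/2⌋}` (so `(w_k, w_{k+1}) = (3K, 4K)` or
`(4K, 6K)`) and `Q = 2^{v₂(r)}`: the bounds of `b ∈ B_{k+1}` and of Lemma 3.2; `r` is even (Lemma 4.1); and EITHER
`Q ∣ w_m` for `m ≥ k` (Lemma 5.3: then `ℓ∞(r) = w_k − Q` or `ℓ1(r) ≥ w_{k+1} − 2Q`, with the divisibility gains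
used in Corollary 5.4 and Lemmas 6.2–6.5 spelled out) OR `Q = 2K ∤ w_k` (Lemma 5.2: then `ℓ∞(r) = 2K` and
`m(r) ∈ {0, 2K}`). [cite: Graves2025, Lemmas 5.1–5.4 (pp. 5–6)] -/
theorem core_package {c d e f : ℤ} {k : ℕ} (hbN : -c < d ∧ d ≤ c) (hrN : -e < f ∧ f ≤ e)
    (hG : IsGaussRemainder ⟨c, d⟩ ⟨e, f⟩) (hb : (⟨c, d⟩ : ℤ√(-1)) ∈ digitSet (k + 1))
    (hr : (⟨e, f⟩ : ℤ√(-1)) ∉ digitSet k) :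
    ∃ K Q : ℤ, 1 ≤ K ∧
      ((width k = 3 * K ∧ width (k + 1) = 4 * K) ∨ (width k = 4 * K ∧ width (k + 1) = 6 * K)) ∧
      c ≤ width (k + 1) - 2 ∧ c + |d| ≤ 2 * width k - 3 ∧ e + |f| ≤ c ∧ 2 * e ≤ c + |d| ∧ (2 ∣ e ∧ 2 ∣ f) ∧
      Q = 2 ^ twoVal (⟨e, f⟩ : ℤ√(-1)) ∧
      ((2 ≤ Q ∧ Q ≤ K ∧ (Q ∣ width k ∧ Q ∣ width (k + 1)) ∧ e ≤ width k - Q ∧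
          (e = width k - Q ∨ (e ≤ width k - 2 * Q ∧ width (k + 1) - 2 * Q ≤ e + |f|)) ∧
          (f = 0 ∨ Q ≤ |f|) ∧ (width (k + 1) - width k ≤ |f| ∨ |f| ≤ width (k + 1) - width k - Q)) ∨
        (Q = 2 * K ∧ e = 2 * K ∧ (f = 0 ∨ |f| = 2 * K))) := by
  have hbC : InNormalCone ⟨c, d⟩ := hbN
  have hrC : InNormalCone ⟨e, f⟩ := hrN
  have hb0 : (⟨c, d⟩ : ℤ√(-1)) ≠ 0 := hbC.ne_zero
  have hr0 : (⟨e, f⟩ : ℤ√(-1)) ≠ 0 := hrC.ne_zero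
  have hc0 : 0 < c := hbC.re_pos
  have he0 : 0 < e := hrC.re_pos
  -- bounds from `b ∈ B_{k+1}` and Lemma 3.2
  obtain ⟨hc, -, hcd⟩ := abs_le_width_of_mem_digitSet_succ hb0 hb
  change |c| ≤ width (k + 1) - 2 at hc
  change |c| + |d| ≤ 2 * width k - 3 at hcd
  rw [abs_of_pos hc0] at hc hcd
  obtain ⟨hG1, hG2⟩ := hG.oneNorm_le hb0
  rw [hrC.oneNorm_eq, hbC.supNorm_eq] at hG1
  rw [hrC.supNorm_eq, hbC.oneNorm_eq] at hG2
  change e + |f| ≤ c at hG1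
  change 2 * e ≤ c + |d| at hG2
  -- `r` is even (Lemma 4.1)
  have hev : 2 ∣ e ∧ 2 ∣ f := by
    by_contra h'
    exact hr (hG.mem_digitSet_of_not_two_dvd hb0 hb h')
  -- `K = 2^{⌊k/2⌋}` and the two width shapes
  obtain ⟨κ, hshape⟩ : ∃ κ : ℕ, (width k = 3 * 2 ^ κ ∧ width (k + 1) = 4 * 2 ^ κ) ∨
      (width k = 4 * 2 ^ κ ∧ width (k + 1) = 6 * 2 ^ κ) := by
    rcases Nat.even_or_odd' k with ⟨a, rfl | rfl⟩
    · exact ⟨a, Or.inl ⟨width_two_mul a, width_two_mul_add_one a⟩⟩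
    · refine ⟨a, Or.inr ⟨width_two_mul_add_one a, ?_⟩⟩
      rw [show 2 * a + 1 + 1 = 2 * (a + 1) by ring, width_two_mul, pow_succ]; ring
  set K : ℤ := 2 ^ κ with hK
  have hK1 : 1 ≤ K := one_le_pow₀ (by norm_num)
  have hw0 : width k = 3 * K ∨ width k = 4 * K := hshape.imp (fun h ↦ h.1) (fun h ↦ h.1)
  -- `Q = 2^{v₂(r)}`, `v₂(r) ≥ 1`
  set v := twoVal ⟨e, f⟩ with hv
  have hv1 : 1 ≤ v := (pow_dvd_iff_le_twoVal hr0).mp (by simpa using hev)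
  set Q : ℤ := 2 ^ v with hQ
  have hQ2 : 2 ≤ Q := by
    rw [hQ, show v = (v - 1) + 1 by omega, pow_succ]
    linarith [one_le_pow₀ (M₀ := ℤ) (a := 2) (n := v - 1) (by norm_num)]
  have hQ0 : 0 < Q := by linarith
  obtain ⟨hQe, hQf⟩ : Q ∣ e ∧ Q ∣ f := pow_twoVal_dvd ⟨e, f⟩
  have hQf' : Q ∣ |f| := (dvd_abs _ _).mpr hQf
  have hQe' : Q ≤ e := Int.le_of_dvd he0 hQe
  -- `r ∉ B_k` through Theorem 2.5 at the exact valuation `v`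
  have hRk : width k - 2 * Q < e ∨ width (k + 1) - 3 * Q < e + |f| := by
    have h' := (not_congr (mem_digitSet_iff_of_exact (n := k) hr0 (pow_twoVal_dvd _)
      (not_pow_twoVal_succ_dvd hr0))).mp hr
    simp only [Int.natCast_natAbs, pow_succ] at h'
    change ¬(|e| ≤ width k - Q * 2 ∧ |f| ≤ width k - Q * 2 ∧ |e| + |f| ≤ width (k + 1) - 3 * Q) at h'
    rw [abs_of_pos he0] at h'
    have hfe : |f| ≤ e := abs_le.mpr ⟨by omega, by omega⟩
    omega
  refine ⟨K, Q, hK1, hshape, hc, hcd, hG1, hG2, hev, hQ, ?_⟩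
  rcases Nat.lt_or_ge κ v with hκv | hκv
  · -- `v ≥ κ + 1`: `2K ∣ Q`, and `Q ≤ e ≤ w_k − 2 < 4K` forces `Q = 2K = e`, `|f| ∈ {0, 2K}`
    right
    have h2K : 2 * K ∣ Q := by
      rw [hK, hQ, ← pow_succ']; exact pow_dvd_pow 2 (by omega)
    obtain ⟨t, ht⟩ := h2K
    have ht1 : 1 ≤ t := by
      by_contra h'
      have : 2 * K * t ≤ 0 := by nlinarith
      omega
    have hQ4 : Q < 4 * K := by omega
    have ht2 : t = 1 := by
      by_contra h'
      have : 2 * K * 2 ≤ 2 * K * t := mul_le_mul_of_nonneg_left (by omega) (by omega)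
      omega
    rw [ht2, mul_one] at ht
    -- `e = Q`
    obtain ⟨s', hs'⟩ := hQe
    have hs1 : s' = 1 := by
      have h1 : 1 ≤ s' := by
        by_contra h'
        have : Q * s' ≤ 0 := by nlinarith
        omega
      by_contra h'
      have : Q * 2 ≤ Q * s' := mul_le_mul_of_nonneg_left (by omega) hQ0.le
      omega
    rw [hs1, mul_one] at hs'
    refine ⟨by omega, by omega, ?_⟩
    obtain ⟨u', hu'⟩ := hQf'
    have hu0 : 0 ≤ u' := by
      by_contra h'
      have : Q * u' < 0 := mul_neg_of_pos_of_neg hQ0 (by omega)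
      linarith [abs_nonneg f]
    have hfe : |f| ≤ e := abs_le.mpr ⟨by omega, by omega⟩
    rcases Int.le_iff_eq_or_lt.mp hu0 with hu | hu
    · left; rw [← abs_eq_zero, hu', ← hu, mul_zero]
    · right
      have hu1 : u' = 1 := by
        by_contra h'
        have : Q * 2 ≤ Q * u' := mul_le_mul_of_nonneg_left (by omega) hQ0.le
        omega
      rw [hu', hu1, mul_one]; omega
  · -- `v ≤ κ`: `Q ∣ K`, hence `Q ∣ w_k, w_{k+1}`; spell out the divisibility gains
    left
    have hQK : Q ∣ K := by rw [hK, hQ]; exact pow_dvd_pow 2 hκv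
    have hQK' : Q ≤ K := Int.le_of_dvd (by omega) hQK
    have hQw0 : Q ∣ width k := by
      rcases hshape with ⟨h, -⟩ | ⟨h, -⟩ <;> rw [h] <;> exact Dvd.dvd.mul_left hQK _
    have hQw1 : Q ∣ width (k + 1) := by
      rcases hshape with ⟨-, h⟩ | ⟨-, h⟩ <;> rw [h] <;> exact Dvd.dvd.mul_left hQK _
    -- gain 1: `e < w_k ⇒ e ≤ w_k − Q`
    have hg1 : e ≤ width k - Q := by
      have hlt : 0 < width k - e := by omega
      linarith [Int.le_of_dvd hlt (dvd_sub hQw0 hQe)]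
    refine ⟨hQ2, hQK', ⟨hQw0, hQw1⟩, hg1, ?_, ?_, ?_⟩
    · by_cases he : e = width k - Q
      · exact Or.inl he
      · right
        have hlt : 0 < width k - Q - e := by omega
        have hg2 : e ≤ width k - 2 * Q := by linarith [Int.le_of_dvd hlt (dvd_sub (dvd_sub hQw0 dvd_rfl) hQe)]
        refine ⟨hg2, ?_⟩
        have h3 : width (k + 1) - 3 * Q < e + |f| := by omega
        have hlt' : 0 < e + |f| - (width (k + 1) - 3 * Q) := by omega
        linarith [Int.le_of_dvd hlt' (dvd_sub (dvd_add hQe hQf') (dvd_sub hQw1 (Dvd.dvd.mul_left dvd_rfl _)))]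
    · by_cases hf : f = 0
      · exact Or.inl hf
      · exact Or.inr (Int.le_of_dvd (abs_pos.mpr hf) hQf')
    · by_cases hfD : width (k + 1) - width k ≤ |f|
      · exact Or.inl hfD
      · right
        have hlt : 0 < width (k + 1) - width k - |f| := by omega
        linarith [Int.le_of_dvd hlt (dvd_sub (dvd_sub hQw1 hQw0) hQf')]

/-- **Proposition 5.5, Lemma 6.3, Lemma 6.5** (reduced normal form): under condition (1) `Im b · Im r ≥ 0`, or
(2) `m(r) + m(b) ≤ ℓ∞(r)`, or (3) `m(b) < ℓ∞(r) < m(b) + m(r)` and `ℓ∞(b) − m(r) > w_k − 2`, the difference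
`b − r` lies in `B_k`. [cite: Graves2025, Prop. 5.5, Lemmas 6.3, 6.5 (pp. 6–9)] -/
theorem sub_mem_digitSet_of_inNormalCone {c d e f : ℤ} {k : ℕ} (hbN : -c < d ∧ d ≤ c) (hrN : -e < f ∧ f ≤ e)
    (hodd : ¬(2 ∣ c ∧ 2 ∣ d)) (hG : IsGaussRemainder ⟨c, d⟩ ⟨e, f⟩) (hb : (⟨c, d⟩ : ℤ√(-1)) ∈ digitSet (k + 1))
    (hr : (⟨e, f⟩ : ℤ√(-1)) ∉ digitSet k)
    (hcond : ((0 ≤ d ∧ 0 ≤ f) ∨ (d ≤ 0 ∧ f ≤ 0)) ∨ |f| + |d| ≤ e ∨ (|d| < e ∧ e < |d| + |f| ∧ width k - 2 < c - |f|)) :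
    (⟨c - e, d - f⟩ : ℤ√(-1)) ∈ digitSet k := by
  obtain ⟨K, Q, hK1, hshape, hc, hcd, hG1, hG2, ⟨he2, hf2⟩, -, hbr⟩ := core_package hbN hrN hG hb hr
  have hodd' : ¬(2 ∣ (⟨c - e, d - f⟩ : ℤ√(-1)).re ∧ 2 ∣ (⟨c - e, d - f⟩ : ℤ√(-1)).im) := by
    change ¬(2 ∣ c - e ∧ 2 ∣ d - f); omega
  rw [mem_digitSet_iff_mem_octagon_of_not_two_dvd hodd', mem_octagon_iff]
  simp only [Int.natCast_natAbs]
  rw [abs_of_nonneg (show 0 ≤ c - e by linarith [abs_nonneg f])]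
  rcases hshape with ⟨hw0, hw1⟩ | ⟨hw0, hw1⟩ <;>
  rcases hbr with ⟨hQ2, hQK, -, hg1, hdis, hfQ, hfD⟩ | ⟨-, he, hf⟩ <;>
  rcases abs_cases d with ⟨hd, _⟩ | ⟨hd, _⟩ <;> rcases abs_cases f with ⟨hf', _⟩ | ⟨hf', _⟩ <;>
  rcases abs_cases (d - f) with ⟨hdf, _⟩ | ⟨hdf, _⟩ <;> omega

/-- **Lemmas 6.2 and 6.4** (reduced normal form): if `Im b · Im r < 0` and neither condition (2) nor (3) holds,
then `b + s(r)·i·r ∈ B_k`. [cite: Graves2025, Lemmas 6.2, 6.4 (pp. 7–8)] -/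
theorem add_mem_digitSet_of_inNormalCone {c d e f : ℤ} {k : ℕ} (hbN : -c < d ∧ d ≤ c) (hrN : -e < f ∧ f ≤ e)
    (hodd : ¬(2 ∣ c ∧ 2 ∣ d)) (hG : IsGaussRemainder ⟨c, d⟩ ⟨e, f⟩) (hb : (⟨c, d⟩ : ℤ√(-1)) ∈ digitSet (k + 1))
    (hr : (⟨e, f⟩ : ℤ√(-1)) ∉ digitSet k)
    (hcond : ¬(((0 ≤ d ∧ 0 ≤ f) ∨ (d ≤ 0 ∧ f ≤ 0)) ∨ |f| + |d| ≤ e ∨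
      (|d| < e ∧ e < |d| + |f| ∧ width k - 2 < c - |f|))) :
    (⟨c, d⟩ + ⟨0, Int.sign f⟩ * ⟨e, f⟩ : ℤ√(-1)) ∈ digitSet k := by
  obtain ⟨K, Q, hK1, hshape, hc, hcd, hG1, hG2, ⟨he2, hf2⟩, -, hbr⟩ := core_package hbN hrN hG hb hr
  have hfc : |f| ≤ c := by linarith [abs_nonneg f]
  rcases lt_trichotomy f 0 with hf0 | hf0 | hf0
  · -- `f < 0`, `s(r) = −1`: `b − i r = (c + f) + (d − e) i`
    have hW : (⟨c, d⟩ + ⟨0, Int.sign f⟩ * ⟨e, f⟩ : ℤ√(-1)) = ⟨c + f, d - e⟩ := by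
      rw [Int.sign_eq_neg_one_of_neg hf0]; ext <;> simp [sub_eq_add_neg]
    rw [hW]
    have hodd' : ¬(2 ∣ (⟨c + f, d - e⟩ : ℤ√(-1)).re ∧ 2 ∣ (⟨c + f, d - e⟩ : ℤ√(-1)).im) := by
      change ¬(2 ∣ c + f ∧ 2 ∣ d - e); omega
    rw [mem_digitSet_iff_mem_octagon_of_not_two_dvd hodd', mem_octagon_iff]
    simp only [Int.natCast_natAbs]
    rw [abs_of_nonneg (show 0 ≤ c + f by rcases abs_cases f with ⟨h, _⟩ | ⟨h, _⟩ <;> omega)]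
    rcases hshape with ⟨hw0, hw1⟩ | ⟨hw0, hw1⟩ <;>
    rcases hbr with ⟨hQ2, hQK, -, hg1, hdis, hfQ, hfD⟩ | ⟨-, he, hf⟩ <;>
    rcases abs_cases d with ⟨hd, _⟩ | ⟨hd, _⟩ <;> rcases abs_cases f with ⟨hf', _⟩ | ⟨hf', _⟩ <;>
    rcases abs_cases (d - e) with ⟨h2, _⟩ | ⟨h2, _⟩ <;> omega
  · exfalso; apply hcond; left
    rcases le_or_gt 0 d with hd | hd
    · exact Or.inl ⟨hd, hf0.ge⟩
    · exact Or.inr ⟨hd.le, hf0.le⟩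
  · -- `f > 0`, `s(r) = 1`: `b + i r = (c − f) + (d + e) i`
    have hW : (⟨c, d⟩ + ⟨0, Int.sign f⟩ * ⟨e, f⟩ : ℤ√(-1)) = ⟨c - f, d + e⟩ := by
      rw [Int.sign_eq_one_of_pos hf0]; ext <;> simp [sub_eq_add_neg]
    rw [hW]
    have hodd' : ¬(2 ∣ (⟨c - f, d + e⟩ : ℤ√(-1)).re ∧ 2 ∣ (⟨c - f, d + e⟩ : ℤ√(-1)).im) := by
      change ¬(2 ∣ c - f ∧ 2 ∣ d + e); omega
    rw [mem_digitSet_iff_mem_octagon_of_not_two_dvd hodd', mem_octagon_iff]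
    simp only [Int.natCast_natAbs]
    rw [abs_of_nonneg (show 0 ≤ c - f by rcases abs_cases f with ⟨h, _⟩ | ⟨h, _⟩ <;> omega)]
    rcases hshape with ⟨hw0, hw1⟩ | ⟨hw0, hw1⟩ <;>
    rcases hbr with ⟨hQ2, hQK, -, hg1, hdis, hfQ, hfD⟩ | ⟨-, he, hf⟩ <;>
    rcases abs_cases d with ⟨hd, _⟩ | ⟨hd, _⟩ <;> rcases abs_cases f with ⟨hf', _⟩ | ⟨hf', _⟩ <;>
    rcases abs_cases (d + e) with ⟨h2, _⟩ | ⟨h2, _⟩ <;> omega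


/-- `Q ∣ w_k` and `Q ∣ w_{k+1}` give `Q ∣ w_m` for all `m ≥ k` (`w_{m+2} = 2w_m`). [cite: Graves2025, §1 (p. 2)] -/
theorem dvd_width_of_le {Q : ℤ} {k : ℕ} (h0 : Q ∣ width k) (h1 : Q ∣ width (k + 1)) {m : ℕ} (hm : k ≤ m) :
    Q ∣ width m := by
  induction m using Nat.strong_induction_on with
  | _ m ih =>
    rcases Nat.lt_or_ge m (k + 2) with hlt | hge
    · rcases (show m = k ∨ m = k + 1 by omega) with rfl | rfl
      · exact h0
      · exact h1
    · obtain ⟨m', rfl⟩ : ∃ m', m = m' + 2 := ⟨m - 2, by omega⟩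
      rw [width_add_two]
      exact Dvd.dvd.mul_left (ih m' (by omega) (by omega)) 2

/-- **Lemma 5.1** (reduced normal form): `ℓ∞(b) − m(b) ≤ w_n − 3·2^{v₂(b)}`, i.e. `c − |d| ≤ w_{k+1} − 3`.
[cite: Graves2025, Lemma 5.1 (p. 5)] -/
theorem re_sub_abs_im_le_width_of_inNormalCone {c d e f : ℤ} {k : ℕ} (hbN : -c < d ∧ d ≤ c) (hrN : -e < f ∧ f ≤ e)
    (hodd : ¬(2 ∣ c ∧ 2 ∣ d)) (hG : IsGaussRemainder ⟨c, d⟩ ⟨e, f⟩) (hb : (⟨c, d⟩ : ℤ√(-1)) ∈ digitSet (k + 1))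
    (hr : (⟨e, f⟩ : ℤ√(-1)) ∉ digitSet k) : c - |d| ≤ width (k + 1) - 3 := by
  obtain ⟨K, Q, hK1, hshape, hc, hcd, -⟩ := core_package hbN hrN hG hb hr
  rcases hshape with ⟨hw0, hw1⟩ | ⟨hw0, hw1⟩ <;> rcases abs_cases d with ⟨hd, _⟩ | ⟨hd, _⟩ <;> omega

/-- **Lemma 5.2** (reduced normal form): if `2^{v₂(r)} ∤ w_{n−1}` then `w_n = 2^{v₂(r)+1}` and `m(r) = 0` (and then
`b − r ∈ B_k` by `sub_mem_digitSet_of_inNormalCone`, condition (1)). [cite: Graves2025, Lemma 5.2 (p. 5)] -/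
theorem im_eq_zero_of_not_pow_twoVal_dvd_width {c d e f : ℤ} {k : ℕ} (hbN : -c < d ∧ d ≤ c) (hrN : -e < f ∧ f ≤ e)
    (hG : IsGaussRemainder ⟨c, d⟩ ⟨e, f⟩) (hb : (⟨c, d⟩ : ℤ√(-1)) ∈ digitSet (k + 1))
    (hr : (⟨e, f⟩ : ℤ√(-1)) ∉ digitSet k) (hndvd : ¬((2 : ℤ) ^ twoVal (⟨e, f⟩ : ℤ√(-1)) ∣ width k)) :
    f = 0 ∧ width (k + 1) = 2 ^ (twoVal (⟨e, f⟩ : ℤ√(-1)) + 1) := by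
  obtain ⟨K, Q, hK1, hshape, hc, hcd, hG1, hG2, -, hQ, hbr⟩ := core_package hbN hrN hG hb hr
  rw [← hQ] at hndvd
  rw [pow_succ, ← hQ]
  rcases hbr with ⟨-, -, ⟨hQw0, -⟩, -⟩ | ⟨hQK, he, hf⟩
  · exact absurd hQw0 hndvd
  rcases hshape with ⟨hw0, hw1⟩ | ⟨hw0, hw1⟩
  · rcases hf with hf | hf
    · exact ⟨hf, by rw [hw1, hQK]; ring⟩
    · exfalso; omega
  · exact absurd (by rw [hw0, hQK]; exact ⟨2, by ring⟩) hndvd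

/-- **Lemma 5.3** (reduced normal form): if `2^{v₂(r)} ∣ w_{n−1}` then `2^{v₂(r)} ∣ w_m` for all `m ≥ n − 1`, either
`ℓ∞(r) = w_{n−1} − 2^{v₂(r)}` or `ℓ1(r) ≥ w_n − 2^{v₂(r)+1}`; in both cases `ℓ∞(r) ≥ w_n − w_{n−1}` and
`ℓ1(r) ≥ w_{n−1} − 2^{v₂(r)}`; and if `ℓ∞(r) ≠ w_{n−1} − 2^{v₂(r)}` then `m(r) ≥ w_n − w_{n−1}`.
[cite: Graves2025, Lemma 5.3 (p. 5)] -/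
theorem supNorm_eq_or_le_oneNorm_of_pow_twoVal_dvd_width {c d e f : ℤ} {k : ℕ} (hbN : -c < d ∧ d ≤ c)
    (hrN : -e < f ∧ f ≤ e) (hG : IsGaussRemainder ⟨c, d⟩ ⟨e, f⟩) (hb : (⟨c, d⟩ : ℤ√(-1)) ∈ digitSet (k + 1))
    (hr : (⟨e, f⟩ : ℤ√(-1)) ∉ digitSet k) (hdvd : (2 : ℤ) ^ twoVal (⟨e, f⟩ : ℤ√(-1)) ∣ width k) :
    (∀ m, k ≤ m → (2 : ℤ) ^ twoVal (⟨e, f⟩ : ℤ√(-1)) ∣ width m) ∧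
      (e = width k - 2 ^ twoVal (⟨e, f⟩ : ℤ√(-1)) ∨
        width (k + 1) - 2 ^ (twoVal (⟨e, f⟩ : ℤ√(-1)) + 1) ≤ e + |f|) ∧
      width (k + 1) - width k ≤ e ∧ width k - 2 ^ twoVal (⟨e, f⟩ : ℤ√(-1)) ≤ e + |f| ∧
      (e ≠ width k - 2 ^ twoVal (⟨e, f⟩ : ℤ√(-1)) → width (k + 1) - width k ≤ |f|) := by
  obtain ⟨K, Q, hK1, hshape, hc, hcd, hG1, hG2, -, hQ, hbr⟩ := core_package hbN hrN hG hb hr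
  rw [pow_succ, ← hQ]
  rw [← hQ] at hdvd
  have hfe : |f| ≤ e := abs_le.mpr ⟨by omega, by omega⟩
  have hf0 : 0 ≤ |f| := abs_nonneg f
  have hd0 : 0 ≤ |d| := abs_nonneg d
  -- in the shape `(w_k, w_{k+1}) = (3K, 4K)` the case `Q = 2K` contradicts `Q ∣ w_k`
  have hexcl : width k = 3 * K → Q = 2 * K → False := by
    intro hw0 hQK
    have h3 : Q ∣ 3 * K - Q := dvd_sub (hw0 ▸ hdvd) dvd_rfl
    rw [hQK, show 3 * K - 2 * K = K by ring] at h3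
    have := Int.le_of_dvd (by omega) h3
    omega
  -- `Q ∣ w_k` and `Q ∣ w_{k+1}` in every consistent branch
  have hQw : Q ∣ width k ∧ Q ∣ width (k + 1) := by
    rcases hbr with ⟨-, -, hQw, -⟩ | ⟨hQK, he, -⟩
    · exact hQw
    rcases hshape with ⟨hw0, hw1⟩ | ⟨hw0, hw1⟩
    · exact (hexcl hw0 hQK).elim
    · rw [hw0, hw1, hQK]
      exact ⟨⟨2, by ring⟩, ⟨3, by ring⟩⟩
  refine ⟨fun m hm ↦ dvd_width_of_le hQw.1 hQw.2 hm, ?_⟩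
  rcases hshape with ⟨hw0, hw1⟩ | ⟨hw0, hw1⟩ <;>
  rcases hbr with ⟨hQ2, hQK, -, hg1, hdis, hfQ, hfD⟩ | ⟨hQK, he, hf⟩
  · refine ⟨?_, ?_, ?_, ?_⟩ <;> omega
  · exact (hexcl hw0 hQK).elim
  · refine ⟨?_, ?_, ?_, ?_⟩ <;> omega
  · refine ⟨?_, ?_, ?_, ?_⟩ <;> omega

/-- **Corollary 5.4** (reduced normal form; it also holds in the case of Lemma 5.2): `m(r)`, `ℓ∞(r)` and
`ℓ∞(b) − ℓ∞(r)` are all `≤ w_{n−1} − 2^{v₂(b)+1} = w_k − 2`. [cite: Graves2025, Cor. 5.4 (p. 6)] -/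
theorem le_width_sub_two_of_inNormalCone {c d e f : ℤ} {k : ℕ} (hbN : -c < d ∧ d ≤ c) (hrN : -e < f ∧ f ≤ e)
    (hG : IsGaussRemainder ⟨c, d⟩ ⟨e, f⟩) (hb : (⟨c, d⟩ : ℤ√(-1)) ∈ digitSet (k + 1))
    (hr : (⟨e, f⟩ : ℤ√(-1)) ∉ digitSet k) : |f| ≤ width k - 2 ∧ e ≤ width k - 2 ∧ c - e ≤ width k - 2 := by
  obtain ⟨K, Q, hK1, hshape, hc, hcd, hG1, hG2, -, -, hbr⟩ := core_package hbN hrN hG hb hr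
  have hfe : |f| ≤ e := abs_le.mpr ⟨by omega, by omega⟩
  rcases hshape with ⟨hw0, hw1⟩ | ⟨hw0, hw1⟩ <;>
  rcases hbr with ⟨hQ2, hQK, -, hg1, hdis, hfQ, hfD⟩ | ⟨-, he, hf⟩ <;> refine ⟨?_, ?_, ?_⟩ <;> omega

/-- **Lemma 6.1**: when `Im(u_b b)` and `Im(u_r r)` have opposite signs,
`u_b b − u_r r = (ℓ∞(b) − ℓ∞(r)) ± (m(b) + m(r)) i` and `u_b b + s(r) i u_r r = (ℓ∞(b) − m(r)) ± (m(b) − ℓ∞(r)) i`.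
[cite: Graves2025, Lemma 6.1 (p. 7)] -/
theorem re_im_of_im_mul_im_neg {b r : ℤ√(-1)} (hb : b ≠ 0) (hr : r ≠ 0)
    (hopp : (normalUnit b * b).im * (normalUnit r * r).im < 0) :
    (normalUnit b * b - normalUnit r * r).re = supNorm b - supNorm r ∧
      |(normalUnit b * b - normalUnit r * r).im| = minAbs b + minAbs r ∧
      (normalUnit b * b + ⟨0, imSign r⟩ * (normalUnit r * r)).re = supNorm b - minAbs r ∧
      |(normalUnit b * b + ⟨0, imSign r⟩ * (normalUnit r * r)).im| = |minAbs b - supNorm r| := by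
  have hbC := inNormalCone_normalUnit_mul hb
  have hrC := inNormalCone_normalUnit_mul hr
  rw [← supNorm_unit_mul (isUnit_normalUnit b) b, ← supNorm_unit_mul (isUnit_normalUnit r) r,
    ← minAbs_unit_mul (isUnit_normalUnit b) b, ← minAbs_unit_mul (isUnit_normalUnit r) r, hbC.supNorm_eq,
    hrC.supNorm_eq, hbC.minAbs_eq, hrC.minAbs_eq, imSign]
  set B := normalUnit b * b
  set R := normalUnit r * r
  have h1 := hbC
  have h2 := hrC
  unfold InNormalCone at h1 h2
  rcases mul_neg_iff.mp hopp with ⟨hB, hR⟩ | ⟨hB, hR⟩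
  · rw [Int.sign_eq_neg_one_of_neg hR]
    have e1 : (B + ⟨0, -1⟩ * R).re = B.re + R.im := by simp [Zsqrtd.re_add, Zsqrtd.re_mul]
    have e2 : (B + ⟨0, -1⟩ * R).im = B.im + -R.re := by simp [Zsqrtd.im_add, Zsqrtd.im_mul]
    rw [Zsqrtd.re_sub, Zsqrtd.im_sub, e1, e2, abs_of_pos hB, abs_of_neg hR]
    refine ⟨rfl, ?_, by ring, ?_⟩
    · rw [abs_of_pos (by linarith)]; ring
    · rw [show B.im - R.re = B.im + -R.re by ring]
  · rw [Int.sign_eq_one_of_pos hR]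
    have e1 : (B + ⟨0, 1⟩ * R).re = B.re + -R.im := by simp [Zsqrtd.re_add, Zsqrtd.re_mul]
    have e2 : (B + ⟨0, 1⟩ * R).im = B.im + R.re := by simp [Zsqrtd.im_add, Zsqrtd.im_mul]
    rw [Zsqrtd.re_sub, Zsqrtd.im_sub, e1, e2, abs_of_neg hB, abs_of_pos hR]
    refine ⟨rfl, ?_, by ring, ?_⟩
    · rw [abs_of_neg (by linarith)]; ring
    · rw [show -B.im - R.re = -(B.im + R.re) by ring, abs_neg]


/-! ## §9 Theorem 1.5: the reduction to the normal form and the two alternate remainders -/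

/-- `(2 : ℤ[i])^v` is the integer `2^v`. [cite: Graves2025, Thm. 1.1 (p. 2)] -/
theorem two_pow_eq_intCast (v : ℕ) : (2 : ℤ√(-1)) ^ v = ((2 ^ v : ℤ) : ℤ√(-1)) := by push_cast; rfl

/-- `u_z` is a digit (`∈ B₀ ∖ 0`). [cite: Graves2025, Def. 1.2 (p. 2)] -/
theorem normalUnit_mem_digits (z : ℤ√(-1)) : normalUnit z ∈ digits := by
  rw [mem_digits_iff]
  rcases normalUnit_mem z with h | h | h | h <;> simp [h]

/-- `conj(u_z)` is a digit. [cite: Graves2025, Def. 1.2 (p. 2)] -/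
theorem star_normalUnit_mem_digits (z : ℤ√(-1)) : star (normalUnit z) ∈ digits := by
  rw [mem_digits_iff]
  rcases normalUnit_mem z with h | h | h | h <;> rw [h] <;> decide

/-- **The reduction** (Lemma 3.1 with `z = u` a unit and `z = 2^{v₂(b)}`, Lemma 4.1): for a Gauss remainder `r ∉ B_k`
modulo `b ∈ B_{k+1} ∖ 0`, writing `u_b b = 2^v b₂`, `u_r r = 2^v r₂` with `v = v₂(b)` one has `k = k' + 2v`,
`b₂, r₂` in the normal cone, `v₂(b₂) = 0`, `r₂` a Gauss remainder modulo `b₂ ∈ B_{k'+1}`, `r₂ ∉ B_{k'}`, and the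
dictionary `ℓ∞(b) = 2^v Re b₂`, `m(b) = 2^v |Im b₂|`, `ℓ∞(r) = 2^v Re r₂`, `m(r) = 2^v |Im r₂|`, `w_k = 2^v w_{k'}`.
[cite: Graves2025, §5 (p. 5)] -/
theorem exists_reduction {b r : ℤ√(-1)} {k : ℕ} (hb0 : b ≠ 0) (hG : IsGaussRemainder b r)
    (hb : b ∈ digitSet (k + 1)) (hr : r ∉ digitSet k) :
    ∃ (k' : ℕ) (b₂ r₂ : ℤ√(-1)), k = k' + 2 * twoVal b ∧
      normalUnit b * b = 2 ^ twoVal b * b₂ ∧ normalUnit r * r = 2 ^ twoVal b * r₂ ∧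
      InNormalCone b₂ ∧ InNormalCone r₂ ∧ ¬(2 ∣ b₂.re ∧ 2 ∣ b₂.im) ∧ IsGaussRemainder b₂ r₂ ∧
      b₂ ∈ digitSet (k' + 1) ∧ r₂ ∉ digitSet k' ∧
      supNorm b = 2 ^ twoVal b * b₂.re ∧ minAbs b = 2 ^ twoVal b * |b₂.im| ∧
      supNorm r = 2 ^ twoVal b * r₂.re ∧ minAbs r = 2 ^ twoVal b * |r₂.im| ∧
      (normalUnit b * b).im = 2 ^ twoVal b * b₂.im ∧ (normalUnit r * r).im = 2 ^ twoVal b * r₂.im ∧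
      width k = 2 ^ twoVal b * width k' := by
  have hr0 : r ≠ 0 := by rintro rfl; exact hr (zero_mem_digitSet k)
  set ub := normalUnit b
  set ur := normalUnit r
  set v := twoVal b with hv
  have hub : IsUnit ub := isUnit_normalUnit b
  have hur : IsUnit ur := isUnit_normalUnit r
  have hb₁0 : ub * b ≠ 0 := mul_ne_zero hub.ne_zero hb0
  have hr₁0 : ur * r ≠ 0 := mul_ne_zero hur.ne_zero hr0
  have hb₁C : InNormalCone (ub * b) := inNormalCone_normalUnit_mul hb0
  have hr₁C : InNormalCone (ur * r) := inNormalCone_normalUnit_mul hr0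
  have hG₁ : IsGaussRemainder (ub * b) (ur * r) := hG.unit_mul hub hur
  have hb₁ : ub * b ∈ digitSet (k + 1) := digit_mul_mem_digitSet (normalUnit_mem_digits b) hb
  have hr₁ : ur * r ∉ digitSet k := by
    intro h
    have h' := digit_mul_mem_digitSet (star_normalUnit_mem_digits r) h
    rw [← mul_assoc, mul_comm (star ur), normalUnit_mul_star, one_mul] at h'
    exact hr h'
  have hvb₁ : twoVal (ub * b) = v := twoVal_unit_mul hub b
  -- Lemma 4.1: `v₂(u_r r) > v`
  have hvr : v + 1 ≤ twoVal (ur * r) := by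
    by_contra hlt
    exact hr₁ (hG₁.mem_digitSet_of_twoVal_le hb₁0 hb₁ (by rw [hvb₁]; omega))
  obtain ⟨hbd1, hbd2⟩ := (pow_dvd_iff_le_twoVal hb₁0).mpr hvb₁.ge
  obtain ⟨hrd1, hrd2⟩ := (pow_dvd_iff_le_twoVal hr₁0).mpr (by omega : v ≤ twoVal (ur * r))
  obtain ⟨b₂, hbb, hbre, hbim⟩ := eq_two_pow_mul hbd1 hbd2
  obtain ⟨r₂, hrr, hrre, hrim⟩ := eq_two_pow_mul hrd1 hrd2
  have hP0 : (0 : ℤ) < 2 ^ v := pow_pos two_pos v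
  have hPne : (2 : ℤ√(-1)) ^ v ≠ 0 := pow_ne_zero _ (by decide)
  have hb₂0 : b₂ ≠ 0 := by rintro rfl; exact hb₁0 (by rw [hbb, mul_zero])
  have hr₂0 : r₂ ≠ 0 := by rintro rfl; exact hr₁0 (by rw [hrr, mul_zero])
  -- cones, parity, Gauss property
  have hb₂C : InNormalCone b₂ := by
    rw [hbb, two_pow_eq_intCast, inNormalCone_intCast_mul_iff hP0] at hb₁C; exact hb₁C
  have hr₂C : InNormalCone r₂ := by
    rw [hrr, two_pow_eq_intCast, inNormalCone_intCast_mul_iff hP0] at hr₁C; exact hr₁C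
  have hb₂odd : ¬(2 ∣ b₂.re ∧ 2 ∣ b₂.im) := by
    rintro ⟨⟨c, hc⟩, ⟨d, hd⟩⟩
    refine not_pow_twoVal_succ_dvd hb₁0 ⟨⟨c, ?_⟩, ⟨d, ?_⟩⟩
    · rw [hvb₁, hbre, hc, pow_succ]; ring
    · rw [hvb₁, hbim, hd, pow_succ]; ring
  have hG₂ : IsGaussRemainder b₂ r₂ := by rw [hbb, hrr, isGaussRemainder_mul_iff hPne] at hG₁; exact hG₁
  -- levels
  rcases Nat.lt_or_ge (k + 1) (2 * v) with hlt | hge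
  · exact absurd hb₁ (hbb ▸ two_pow_mul_not_mem_digitSet hb₂0 hlt)
  rcases Nat.eq_or_lt_of_le hge with heq | hlt
  · exfalso
    have hb₂u : b₂ ∈ digitSet 0 := by
      rw [hbb, show k + 1 = 0 + 2 * v by omega, two_pow_mul_mem_digitSet_iff] at hb₁; exact hb₁
    exact hr₂0 (hG₂.eq_zero_of_isUnit (isUnit_of_mem_digitSet_zero hb₂u hb₂0))
  obtain ⟨k', rfl⟩ : ∃ k', k = k' + 2 * v := ⟨k - 2 * v, by omega⟩
  have hb₂ : b₂ ∈ digitSet (k' + 1) := by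
    rw [hbb, show k' + 2 * v + 1 = (k' + 1) + 2 * v by ring, two_pow_mul_mem_digitSet_iff] at hb₁; exact hb₁
  have hr₂ : r₂ ∉ digitSet k' := fun h ↦ hr₁ (by rw [hrr, two_pow_mul_mem_digitSet_iff]; exact h)
  refine ⟨k', b₂, r₂, rfl, hbb, hrr, hb₂C, hr₂C, hb₂odd, hG₂, hb₂, hr₂, ?_, ?_, ?_, ?_, hbim, hrim, ?_⟩
  · rw [← supNorm_unit_mul hub b, hb₁C.supNorm_eq, hbre]
  · rw [← minAbs_unit_mul hub b, hb₁C.minAbs_eq, hbim, abs_mul, abs_of_pos hP0]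
  · rw [← supNorm_unit_mul hur r, hr₁C.supNorm_eq, hrre]
  · rw [← minAbs_unit_mul hur r, hr₁C.minAbs_eq, hrim, abs_mul, abs_of_pos hP0]
  · rw [width_add_two_mul]

/-- **Theorem 1.5, first alternative** (with `φ(b) ≤ n := k+1 ≤ φ(r)` in the form `b ∈ B_{k+1}`, `r ∉ B_k`): if
(1) `Im(u_b b) Im(u_r r) ≥ 0`, or (2) `m(r) + m(b) ≤ ℓ∞(r)`, or (3) `m(b) < ℓ∞(r) < m(b) + m(r)` and
`ℓ∞(b) − m(r) > w_{n−1} − 2^{v₂(b)+1}`, then the alternate remainder `r − (u_b/u_r) b` lies in `B_{n−1}`, i.e.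
`φ(r − (u_b/u_r) b) < n`.  (`u_b/u_r = u_b · conj(u_r)`.) [cite: Graves2025, Thm. 1.5 (p. 3)] -/
theorem sub_unit_mul_mem_digitSet {b r : ℤ√(-1)} {k : ℕ} (hb0 : b ≠ 0) (hG : IsGaussRemainder b r)
    (hb : b ∈ digitSet (k + 1)) (hr : r ∉ digitSet k)
    (hcond : 0 ≤ (normalUnit b * b).im * (normalUnit r * r).im ∨ minAbs r + minAbs b ≤ supNorm r ∨
      (minAbs b < supNorm r ∧ supNorm r < minAbs b + minAbs r ∧
        width k - 2 ^ (twoVal b + 1) < supNorm b - minAbs r)) :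
    r - normalUnit b * star (normalUnit r) * b ∈ digitSet k := by
  obtain ⟨k', b₂, r₂, hk, hbb, hrr, hb₂C, hr₂C, hb₂odd, hG₂, hb₂, hr₂, hLb, hMb, hLr, hMr, hIb, hIr, hwk⟩ :=
    exists_reduction hb0 hG hb hr
  set v := twoVal b
  have hP0 : (0 : ℤ) < 2 ^ v := pow_pos two_pos v
  obtain ⟨c, d⟩ := b₂
  obtain ⟨e, f⟩ := r₂
  simp only at hLb hMb hLr hMr hIb hIr hb₂odd
  -- the three conditions, descaled
  have hcond' : ((0 ≤ d ∧ 0 ≤ f) ∨ (d ≤ 0 ∧ f ≤ 0)) ∨ |f| + |d| ≤ e ∨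
      (|d| < e ∧ e < |d| + |f| ∧ width k' - 2 < c - |f|) := by
    rw [hIb, hIr, hLb, hMb, hLr, hMr, hwk, pow_succ] at hcond
    rcases hcond with h | h | ⟨h1, h2, h3⟩
    · left
      rw [mul_mul_mul_comm, mul_nonneg_iff_of_pos_left (mul_pos hP0 hP0), mul_nonneg_iff] at h
      exact h
    · right; left
      rw [← mul_add] at h
      exact le_of_mul_le_mul_left h hP0
    · right; right
      rw [← mul_add] at h2
      rw [← mul_sub, ← mul_sub] at h3
      exact ⟨lt_of_mul_lt_mul_left h1 hP0.le, lt_of_mul_lt_mul_left h2 hP0.le, lt_of_mul_lt_mul_left h3 hP0.le⟩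
  have hW := sub_mem_digitSet_of_inNormalCone (k := k') hb₂C hr₂C hb₂odd hG₂ hb₂ hr₂ hcond'
  -- rescale and rotate back: `r − u_b conj(u_r) b = −conj(u_r) · 2^v (b₂ − r₂)`
  have hsub : (⟨c, d⟩ - ⟨e, f⟩ : ℤ√(-1)) = ⟨c - e, d - f⟩ := by ext <;> simp
  have hW' : (2 : ℤ√(-1)) ^ v * (⟨c, d⟩ - ⟨e, f⟩) ∈ digitSet k := by
    rw [hk, two_pow_mul_mem_digitSet_iff, hsub]
    exact hW
  have hid : r - normalUnit b * star (normalUnit r) * b =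
      -(star (normalUnit r) * ((2 : ℤ√(-1)) ^ v * (⟨c, d⟩ - ⟨e, f⟩))) := by
    rw [mul_sub, ← hbb, ← hrr]
    linear_combination (-r) * normalUnit_mul_star r
  rw [hid]
  exact neg_mem_digitSet (digit_mul_mem_digitSet (star_normalUnit_mem_digits r) hW')

/-- **Theorem 1.5, second alternative**: if none of the conditions (1)–(3) holds, the alternate remainder
`r − (i u_b/(s(r) u_r)) b` lies in `B_{n−1}` (`φ < n`); here `i u_b/(s(r) u_r) = s(r) i u_b conj(u_r)` since
`s(r) = ±1`. [cite: Graves2025, Thm. 1.5 (p. 3)] -/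
theorem sub_i_unit_mul_mem_digitSet {b r : ℤ√(-1)} {k : ℕ} (hb0 : b ≠ 0) (hG : IsGaussRemainder b r)
    (hb : b ∈ digitSet (k + 1)) (hr : r ∉ digitSet k)
    (hcond : ¬(0 ≤ (normalUnit b * b).im * (normalUnit r * r).im ∨ minAbs r + minAbs b ≤ supNorm r ∨
      (minAbs b < supNorm r ∧ supNorm r < minAbs b + minAbs r ∧
        width k - 2 ^ (twoVal b + 1) < supNorm b - minAbs r))) :
    r - ⟨0, imSign r⟩ * normalUnit b * star (normalUnit r) * b ∈ digitSet k := by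
  obtain ⟨k', b₂, r₂, hk, hbb, hrr, hb₂C, hr₂C, hb₂odd, hG₂, hb₂, hr₂, hLb, hMb, hLr, hMr, hIb, hIr, hwk⟩ :=
    exists_reduction hb0 hG hb hr
  set v := twoVal b
  have hP0 : (0 : ℤ) < 2 ^ v := pow_pos two_pos v
  obtain ⟨c, d⟩ := b₂
  obtain ⟨e, f⟩ := r₂
  simp only at hLb hMb hLr hMr hIb hIr hb₂odd
  have hcond' : ¬(((0 ≤ d ∧ 0 ≤ f) ∨ (d ≤ 0 ∧ f ≤ 0)) ∨ |f| + |d| ≤ e ∨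
      (|d| < e ∧ e < |d| + |f| ∧ width k' - 2 < c - |f|)) := by
    contrapose! hcond
    rw [hIb, hIr, hLb, hMb, hLr, hMr, hwk, pow_succ]
    rcases hcond with h | h | ⟨h1, h2, h3⟩
    · left
      rw [mul_mul_mul_comm, mul_nonneg_iff_of_pos_left (mul_pos hP0 hP0), mul_nonneg_iff]
      exact h
    · right; left
      rw [← mul_add]
      exact mul_le_mul_of_nonneg_left h hP0.le
    · right; right
      rw [← mul_add, ← mul_sub, ← mul_sub]
      exact ⟨mul_lt_mul_of_pos_left h1 hP0, mul_lt_mul_of_pos_left h2 hP0, mul_lt_mul_of_pos_left h3 hP0⟩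
  have hW := add_mem_digitSet_of_inNormalCone (k := k') hb₂C hr₂C hb₂odd hG₂ hb₂ hr₂ hcond'
  -- `s(r) = sgn(Im(u_r r)) = sgn f = ±1`
  have hs : imSign r = Int.sign f := by
    rw [imSign, hIr, Int.sign_mul, Int.sign_eq_one_of_pos hP0, one_mul]
  have hf0 : f ≠ 0 := by
    rintro rfl
    exact hcond' (Or.inl ((le_or_gt 0 d).elim (fun h ↦ Or.inl ⟨h, le_rfl⟩) (fun h ↦ Or.inr ⟨h.le, le_rfl⟩)))
  have hss : (⟨0, Int.sign f⟩ * ⟨0, Int.sign f⟩ : ℤ√(-1)) = -1 := by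
    rcases lt_or_gt_of_ne hf0 with h | h
    · rw [Int.sign_eq_neg_one_of_neg h]; decide
    · rw [Int.sign_eq_one_of_pos h]; decide
  have hsd : (⟨0, Int.sign f⟩ : ℤ√(-1)) ∈ digits := by
    rcases lt_or_gt_of_ne hf0 with h | h
    · rw [Int.sign_eq_neg_one_of_neg h]; exact negI_mem_digits
    · rw [Int.sign_eq_one_of_pos h]; exact i_mem_digits
  have hW' : (2 : ℤ√(-1)) ^ v * (⟨c, d⟩ + ⟨0, Int.sign f⟩ * ⟨e, f⟩) ∈ digitSet k := by
    rw [hk, two_pow_mul_mem_digitSet_iff]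
    exact hW
  have hid : r - ⟨0, imSign r⟩ * normalUnit b * star (normalUnit r) * b =
      -(⟨0, Int.sign f⟩ * (star (normalUnit r) * ((2 : ℤ√(-1)) ^ v * (⟨c, d⟩ + ⟨0, Int.sign f⟩ * ⟨e, f⟩)))) := by
    rw [hs, mul_add, mul_left_comm _ (⟨0, Int.sign f⟩ : ℤ√(-1)), ← hbb, ← hrr]
    linear_combination (r * (normalUnit r * star (normalUnit r))) * hss + (-r) * normalUnit_mul_star r
  rw [hid]
  exact neg_mem_digitSet (digit_mul_mem_digitSet hsd (digit_mul_mem_digitSet (star_normalUnit_mem_digits r) hW'))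


/-! ## §10 Theorem 1.5 for `φ_{ℤ[i]}` (Motzkin's minimal Euclidean function `motzkinNorm`) -/

/-- `φ(0) = 0` (Motzkin's convention `|0| = 0`). [cite: Graves2025, §1 (p. 1)] -/
theorem motzkinNorm_zero : motzkinNorm forall_exists_not_mem_motzkinSet (0 : ℤ√(-1)) = 0 := by
  unfold motzkinNorm
  rw [(motzkinRank_eq_zero_iff forall_exists_not_mem_motzkinSet).mpr rfl]

/-- The setting of Theorem 1.5 in terms of the digit sets: if `r ≠ 0` is a Gauss remainder modulo `b ≠ 0` with
`φ(r) ≥ φ(b) = n`, then `n = k + 1 ≥ 1`, `b ∈ B_{k+1}` and `r ∉ B_k`. [cite: Graves2025, Thm. 1.5 (p. 3)] -/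
theorem exists_motzkinNorm_eq_succ {b r : ℤ√(-1)} (hG : IsGaussRemainder b r) (hb0 : b ≠ 0) (hr0 : r ≠ 0)
    (hφ : motzkinNorm forall_exists_not_mem_motzkinSet b ≤ motzkinNorm forall_exists_not_mem_motzkinSet r) :
    ∃ k : ℕ, motzkinNorm forall_exists_not_mem_motzkinSet b = k + 1 ∧ b ∈ digitSet (k + 1) ∧ r ∉ digitSet k := by
  set n := motzkinNorm forall_exists_not_mem_motzkinSet b with hn
  have hbn : b ∈ digitSet n := mem_digitSet_motzkinNorm hb0
  have hbu : ¬IsUnit b := fun hu ↦ hr0 (hG.eq_zero_of_isUnit hu)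
  obtain ⟨k, hk⟩ : ∃ k, n = k + 1 := by
    rcases Nat.eq_zero_or_eq_succ_pred n with h0 | hS
    · exact absurd (isUnit_of_mem_digitSet_zero (h0 ▸ hbn) hb0) hbu
    · exact ⟨n - 1, hS⟩
  refine ⟨k, hk, hk ▸ hbn, not_mem_digitSet_of_lt_motzkinNorm hr0 (by omega)⟩

/-- `W ∈ B_k ⇒ φ(W) < k + 1`. [cite: Graves2025, Thm. 1.1 (p. 2)] -/
theorem motzkinNorm_lt_succ_of_mem_digitSet {W : ℤ√(-1)} {k : ℕ} (hW : W ∈ digitSet k) :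
    motzkinNorm forall_exists_not_mem_motzkinSet W < k + 1 := by
  by_cases hW0 : W = 0
  · rw [hW0, motzkinNorm_zero]; omega
  have := (motzkinNorm_le_iff_mem_digitSet hW0 k).mpr hW
  omega

/-- **Theorem 1.5** (first alternative, as printed): «Suppose `a, b ∈ ℤ[i] ∖ {0}` have Gauss quotient `q` and
non-zero Gauss remainder `r` with `φ(r) ≥ φ(b) = n`.  If (1) `Im(u_b b) Im(u_r r) ≥ 0`, or (2) `m(r) + m(b) ≤ ℓ∞(r)`,
or (3) `m(b) < ℓ∞(r) < m(b) + m(r)` and `ℓ∞(b) − m(r) > w_{n−1} − 2^{v₂(b)+1}`, then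
`a = (q + u_b/u_r) b + (r − (u_b/u_r) b)` with `φ(r − (u_b/u_r) b) < φ(b)`.» [cite: Graves2025, Thm. 1.5 (p. 3)] -/
theorem eq_mul_add_of_gaussRemainder_of_cond {a b q r : ℤ√(-1)} (hb0 : b ≠ 0) (hr0 : r ≠ 0)
    (hdiv : a = q * b + r) (hG : IsGaussRemainder b r)
    (hφ : motzkinNorm forall_exists_not_mem_motzkinSet b ≤ motzkinNorm forall_exists_not_mem_motzkinSet r)
    (hcond : 0 ≤ (normalUnit b * b).im * (normalUnit r * r).im ∨ minAbs r + minAbs b ≤ supNorm r ∨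
      (minAbs b < supNorm r ∧ supNorm r < minAbs b + minAbs r ∧
        width (motzkinNorm forall_exists_not_mem_motzkinSet b - 1) - 2 ^ (twoVal b + 1) < supNorm b - minAbs r)) :
    a = (q + normalUnit b * star (normalUnit r)) * b + (r - normalUnit b * star (normalUnit r) * b) ∧
      motzkinNorm forall_exists_not_mem_motzkinSet (r - normalUnit b * star (normalUnit r) * b) <
        motzkinNorm forall_exists_not_mem_motzkinSet b := by
  refine ⟨by rw [hdiv]; ring, ?_⟩
  obtain ⟨k, hk, hb, hr⟩ := exists_motzkinNorm_eq_succ hG hb0 hr0 hφ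
  rw [hk, Nat.add_sub_cancel] at hcond
  rw [hk]
  exact motzkinNorm_lt_succ_of_mem_digitSet (sub_unit_mul_mem_digitSet hb0 hG hb hr hcond)

/-- **Theorem 1.5** (second alternative, as printed): «Otherwise, `a = (q + i u_b/(s(r) u_r)) b + (r − (i u_b/(s(r) u_r)) b)`
with `φ(r − (i u_b/(s(r) u_r)) b) < φ(b)`» (`1/s(r) = s(r)`, `1/u_r = conj(u_r)`). [cite: Graves2025, Thm. 1.5 (p. 3)] -/
theorem eq_mul_add_of_gaussRemainder_of_not_cond {a b q r : ℤ√(-1)} (hb0 : b ≠ 0) (hr0 : r ≠ 0)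
    (hdiv : a = q * b + r) (hG : IsGaussRemainder b r)
    (hφ : motzkinNorm forall_exists_not_mem_motzkinSet b ≤ motzkinNorm forall_exists_not_mem_motzkinSet r)
    (hcond : ¬(0 ≤ (normalUnit b * b).im * (normalUnit r * r).im ∨ minAbs r + minAbs b ≤ supNorm r ∨
      (minAbs b < supNorm r ∧ supNorm r < minAbs b + minAbs r ∧
        width (motzkinNorm forall_exists_not_mem_motzkinSet b - 1) - 2 ^ (twoVal b + 1) < supNorm b - minAbs r))) :
    a = (q + ⟨0, imSign r⟩ * normalUnit b * star (normalUnit r)) * b +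
        (r - ⟨0, imSign r⟩ * normalUnit b * star (normalUnit r) * b) ∧
      motzkinNorm forall_exists_not_mem_motzkinSet (r - ⟨0, imSign r⟩ * normalUnit b * star (normalUnit r) * b) <
        motzkinNorm forall_exists_not_mem_motzkinSet b := by
  refine ⟨by rw [hdiv]; ring, ?_⟩
  obtain ⟨k, hk, hb, hr⟩ := exists_motzkinNorm_eq_succ hG hb0 hr0 hφ
  rw [hk, Nat.add_sub_cancel] at hcond
  rw [hk]
  exact motzkinNorm_lt_succ_of_mem_digitSet (sub_i_unit_mul_mem_digitSet hb0 hG hb hr hcond)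

/-- **The division algorithm for `φ_{ℤ[i]}` made explicit** (abstract + §§3–6): starting from Gauss's
`a = (a / b) b + (a % b)` (Mathlib's Euclidean division of `ℤ[i]`), either the Gauss remainder already satisfies
`φ(a % b) < φ(b)` or one of the two adjustments of Theorem 1.5 does; in every case the new remainder lies in
`(a % b) + {0, −u_b ū_r b, −s i u_b ū_r b}`. [cite: Graves2025, Thm. 1.5 (p. 3)] -/
theorem exists_explicit_remainder (a : ℤ√(-1)) {b : ℤ√(-1)} (hb0 : b ≠ 0) :
    ∃ t : ℤ√(-1), (t = 0 ∨ t = normalUnit b * star (normalUnit (a % b)) ∨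
        t = ⟨0, imSign (a % b)⟩ * normalUnit b * star (normalUnit (a % b))) ∧
      a = (a / b + t) * b + (a % b - t * b) ∧
      (a % b - t * b = 0 ∨ motzkinNorm forall_exists_not_mem_motzkinSet (a % b - t * b) <
        motzkinNorm forall_exists_not_mem_motzkinSet b) := by
  have hdiv : a = a / b * b + a % b := (div_mul_add_mod_eq a b).symm
  have hG := isGaussRemainder_mod a b
  by_cases hr0 : a % b = 0
  · exact ⟨0, Or.inl rfl, by rw [add_zero, zero_mul, sub_zero]; exact hdiv, Or.inl (by rw [hr0, zero_mul, sub_zero])⟩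
  by_cases hφ : motzkinNorm forall_exists_not_mem_motzkinSet (a % b) < motzkinNorm forall_exists_not_mem_motzkinSet b
  · exact ⟨0, Or.inl rfl, by rw [add_zero, zero_mul, sub_zero]; exact hdiv, Or.inr (by rwa [zero_mul, sub_zero])⟩
  rw [not_lt] at hφ
  by_cases hcond : 0 ≤ (normalUnit b * b).im * (normalUnit (a % b) * (a % b)).im ∨
      minAbs (a % b) + minAbs b ≤ supNorm (a % b) ∨
      (minAbs b < supNorm (a % b) ∧ supNorm (a % b) < minAbs b + minAbs (a % b) ∧
        width (motzkinNorm forall_exists_not_mem_motzkinSet b - 1) - 2 ^ (twoVal b + 1) <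
          supNorm b - minAbs (a % b))
  · obtain ⟨h1, h2⟩ := eq_mul_add_of_gaussRemainder_of_cond hb0 hr0 hdiv hG hφ hcond
    exact ⟨_, Or.inr (Or.inl rfl), h1, Or.inr h2⟩
  · obtain ⟨h1, h2⟩ := eq_mul_add_of_gaussRemainder_of_not_cond hb0 hr0 hdiv hG hφ hcond
    exact ⟨_, Or.inr (Or.inr rfl), h1, Or.inr h2⟩


/-! ## §11 Corollary 3.3: in the setting of Theorem 1.5 the inequalities of Lemma 3.2 are strict -/

/-- Mixed strict form of the key estimate: strict as soon as one usable slack is available.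
[cite: Graves2025, Lemma 3.2 (p. 4)] -/
theorem two_mul_lt_of_abs_le_of_or {A B N : ℤ} (hA : 2 * |A| ≤ N) (hB : 2 * |B| ≤ N) {s t : ℤ}
    (h : (2 * |A| < N ∧ s ≠ 0) ∨ (2 * |B| < N ∧ t ≠ 0)) : 2 * (A * s + B * t) < N * (|s| + |t|) := by
  have h1 : A * s ≤ |A| * |s| := by rw [← abs_mul]; exact le_abs_self _
  have h2 : B * t ≤ |B| * |t| := by rw [← abs_mul]; exact le_abs_self _
  have h3 : 2 * |A| * |s| ≤ N * |s| := mul_le_mul_of_nonneg_right hA (abs_nonneg s)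
  have h4 : 2 * |B| * |t| ≤ N * |t| := mul_le_mul_of_nonneg_right hB (abs_nonneg t)
  rcases h with ⟨hA', h0⟩ | ⟨hB', h0⟩
  · have h3' : 2 * |A| * |s| < N * |s| := mul_lt_mul_of_pos_right hA' (abs_pos.mpr h0)
    linarith
  · have h4' : 2 * |B| * |t| < N * |t| := mul_lt_mul_of_pos_right hB' (abs_pos.mpr h0)
    linarith

/-- If both coordinates of `b` are non-zero and `r/b` is not the double tie `(±1 ± i)/2`, then
`2ℓ∞(r) < ℓ1(b)`. [cite: Graves2025, Lemma 3.2 (p. 4)] -/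
theorem IsGaussRemainder.two_mul_supNorm_lt {b r : ℤ√(-1)} (h : IsGaussRemainder b r) (hx : b.re ≠ 0)
    (hy : b.im ≠ 0) (hAB : ¬(2 * |(r * star b).re| = b.norm ∧ 2 * |(r * star b).im| = b.norm)) :
    2 * supNorm r < oneNorm b := by
  obtain ⟨hA, hB⟩ := h
  set A := (r * star b).re
  set B := (r * star b).im
  set N := b.norm
  have hb : b ≠ 0 := fun h' ↦ hx (by rw [h']; rfl)
  have hN0 : 0 < N := lt_of_le_of_ne (Zsqrtd.norm_nonneg (by norm_num) b)
    (fun h ↦ hb ((Zsqrtd.norm_eq_zero_iff (by norm_num) b).mp h.symm))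
  obtain ⟨hg, hh⟩ := norm_mul_re_im b r
  set x := b.re; set y := b.im; set g := r.re
  have hor : 2 * |A| < N ∨ 2 * |B| < N := by
    by_contra h'; push Not at h'; exact hAB ⟨le_antisymm hA h'.1, le_antisymm hB h'.2⟩
  have key : ∀ s t : ℤ, s ≠ 0 → t ≠ 0 → 2 * (A * s + B * t) < N * (|s| + |t|) := fun s t hs ht ↦
    two_mul_lt_of_abs_le_of_or hA hB (hor.imp (fun h' ↦ ⟨h', hs⟩) (fun h' ↦ ⟨h', ht⟩))
  unfold oneNorm supNorm
  have e1 : N * g * 2 = 2 * (A * x + B * (-y)) := by rw [hg]; ring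
  have e2 : N * (-g) * 2 = 2 * (A * (-x) + B * y) := by rw [mul_neg, hg]; ring
  have e3 : N * r.im * 2 = 2 * (A * y + B * x) := by rw [hh]; ring
  have e4 : N * (-r.im) * 2 = 2 * (A * (-y) + B * (-x)) := by rw [mul_neg, hh]; ring
  have k1 := key x (-y) hx (neg_ne_zero.mpr hy)
  have k2 := key (-x) y (neg_ne_zero.mpr hx) hy
  have k3 := key y x hy hx
  have k4 := key (-y) (-x) (neg_ne_zero.mpr hy) (neg_ne_zero.mpr hx)
  rw [abs_neg] at k1 k2 k4
  rw [abs_neg] at k4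
  have l1 : g * 2 < |x| + |y| := lt_of_mul_lt_mul_left (by linarith) hN0.le
  have l2 : -g * 2 < |x| + |y| := lt_of_mul_lt_mul_left (by linarith) hN0.le
  have l3 : r.im * 2 < |x| + |y| := lt_of_mul_lt_mul_left (by linarith) hN0.le
  have l4 : -r.im * 2 < |x| + |y| := lt_of_mul_lt_mul_left (by linarith) hN0.le
  rcases abs_cases g with ⟨h1, _⟩ | ⟨h1, _⟩ <;> rcases abs_cases r.im with ⟨h2, _⟩ | ⟨h2, _⟩ <;>
    rcases max_cases |g| |r.im| with ⟨h3, _⟩ | ⟨h3, _⟩ <;> linarith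

/-- The double tie `r/b = (±1 ± i)/2` means `2r = u(1+i) b`, so `b ∈ (1+i)·unit·r` and `φ(r) = φ(b) − 1`:
if `b ∈ B_{k+1}` then `r ∈ B_k`. [cite: Graves2025, Cor. 3.3 (p. 4)] -/
theorem mem_digitSet_of_tie_tie {b r : ℤ√(-1)} {k : ℕ} (hb0 : b ≠ 0) (hb : b ∈ digitSet (k + 1))
    (hA : 2 * |(r * star b).re| = b.norm) (hB : 2 * |(r * star b).im| = b.norm) : r ∈ digitSet k := by
  set A := (r * star b).re
  set B := (r * star b).im
  set N := b.norm
  have hN0 : 0 < N := lt_of_le_of_ne (Zsqrtd.norm_nonneg (by norm_num) b)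
    (fun h ↦ hb0 ((Zsqrtd.norm_eq_zero_iff (by norm_num) b).mp h.symm))
  obtain ⟨hg, hh⟩ := norm_mul_re_im b r
  -- `2r = w b` with `w = σ + τ i`, `2A = σN`, `2B = τN`
  obtain ⟨σ, hσ, hσA⟩ : ∃ σ : ℤ, (σ = 1 ∨ σ = -1) ∧ 2 * A = σ * N := by
    rcases abs_cases A with ⟨h', -⟩ | ⟨h', -⟩
    · exact ⟨1, Or.inl rfl, by linarith⟩
    · exact ⟨-1, Or.inr rfl, by linarith⟩
  obtain ⟨τ, hτ, hτB⟩ : ∃ τ : ℤ, (τ = 1 ∨ τ = -1) ∧ 2 * B = τ * N := by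
    rcases abs_cases B with ⟨h', -⟩ | ⟨h', -⟩
    · exact ⟨1, Or.inl rfl, by linarith⟩
    · exact ⟨-1, Or.inr rfl, by linarith⟩
  have h2r : 2 * r = ⟨σ, τ⟩ * b := by
    have e1 : N * (2 * r.re) = N * (σ * b.re - τ * b.im) := by
      linear_combination 2 * hg + b.re * hσA - b.im * hτB
    have e2 : N * (2 * r.im) = N * (σ * b.im + τ * b.re) := by
      linear_combination 2 * hh + b.im * hσA + b.re * hτB
    have e1' := mul_left_cancel₀ hN0.ne' e1
    have e2' := mul_left_cancel₀ hN0.ne' e2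
    rw [show (2 : ℤ√(-1)) = ⟨2, 0⟩ by decide]
    ext
    · simp only [Zsqrtd.re_mul]; linarith
    · simp only [Zsqrtd.im_mul]; linarith
  -- in each of the four cases `(1+i) ω (σ + τ i) = 2` for a digit `ω`, so `b = (1+i)(ω r)`
  obtain ⟨ω, hω, hω2⟩ : ∃ ω : ℤ√(-1), ω ∈ digits ∧ (⟨1, 1⟩ : ℤ√(-1)) * ω * ⟨σ, τ⟩ = 2 := by
    rcases hσ with rfl | rfl <;> rcases hτ with rfl | rfl
    · exact ⟨⟨0, -1⟩, negI_mem_digits, by decide⟩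
    · exact ⟨1, one_mem_digits, by decide⟩
    · exact ⟨-1, neg_mem_digits one_mem_digits, by decide⟩
    · exact ⟨⟨0, 1⟩, i_mem_digits, by decide⟩
  have hfac : (⟨1, 1⟩ : ℤ√(-1)) * (ω * r) = b := by
    have h2 : (2 : ℤ√(-1)) ≠ 0 := by decide
    apply mul_left_cancel₀ h2
    calc (2 : ℤ√(-1)) * (⟨1, 1⟩ * (ω * r)) = ⟨1, 1⟩ * ω * (2 * r) := by ring
      _ = ⟨1, 1⟩ * ω * ⟨σ, τ⟩ * b := by rw [h2r]; ring
      _ = 2 * b := by rw [hω2]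
  rw [← hfac, oneAddI_mul_mem_digitSet_succ_iff] at hb
  -- `r = ω⁻¹ (ω r)` with `ω⁻¹ = conj ω` a digit
  have hωu : IsUnit ω := by
    rcases mem_digits_iff.mp hω with rfl | rfl | rfl | rfl | rfl
    · exact absurd hω2 (by simp)
    · exact isUnit_one
    · exact isUnit_one.neg
    · exact isUnit_i
    · exact ZSqrt.isUnit_iff_neg_one.mpr (by simp)
  have hωω : star ω * ω = 1 := by
    rw [mul_comm, ← Zsqrtd.norm_eq_mul_conj, (Zsqrtd.norm_eq_one_iff' (by norm_num) ω).mpr hωu]; rfl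
  have := digit_mul_mem_digitSet (star_mem_digits hω) hb
  rwa [← mul_assoc, hωω, one_mul] at this

/-- **Corollary 3.3**: «If `a, b ∈ ℤ[i] ∖ {0}` have Gauss remainder `r` and `φ(r) ≥ φ(b)`, then
`ℓ∞(r) < ℓ1(b)/2` and `ℓ1(r) < ℓ∞(b)`» — here with `φ(b) ≤ k + 1 ≤ φ(r)` as `b ∈ B_{k+1}`, `r ∉ B_k`.  (Proof:
after the reduction of §9, either `N(b)` is odd (open square), or both coordinates of `b` are odd while `r` is even
(parity, and the double tie is excluded by `mem_digitSet_of_tie_tie`).) [cite: Graves2025, Cor. 3.3 (p. 4)] -/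
theorem IsGaussRemainder.oneNorm_lt_supNorm {b r : ℤ√(-1)} {k : ℕ} (hG : IsGaussRemainder b r) (hb0 : b ≠ 0)
    (hb : b ∈ digitSet (k + 1)) (hr : r ∉ digitSet k) : oneNorm r < supNorm b ∧ 2 * supNorm r < oneNorm b := by
  obtain ⟨k', b₂, r₂, hk, hbb, hrr, hb₂C, hr₂C, hb₂odd, hG₂, hb₂, hr₂, hLb, hMb, hLr, hMr, -, -, -⟩ :=
    exists_reduction hb0 hG hb hr
  set v := twoVal b
  have hP0 : (0 : ℤ) < 2 ^ v := pow_pos two_pos v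
  rw [oneNorm_eq_supNorm_add_minAbs, oneNorm_eq_supNorm_add_minAbs, hLb, hMb, hLr, hMr, ← mul_add, ← mul_add,
    mul_left_comm]
  obtain ⟨c, d⟩ := b₂
  obtain ⟨e, f⟩ := r₂
  simp only at hb₂odd ⊢
  suffices H : e + |f| < c ∧ 2 * e < c + |d| from
    ⟨mul_lt_mul_of_pos_left H.1 hP0, mul_lt_mul_of_pos_left H.2 hP0⟩
  obtain ⟨K, Q, -, -, -, -, hG1, hG2, ⟨he2, hf2⟩, -⟩ :=
    core_package (c := c) (d := d) (e := e) (f := f) hb₂C hr₂C hG₂ hb₂ hr₂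
  have hc0 : 0 < c := hb₂C.re_pos
  by_cases hN : 2 ∣ Zsqrtd.norm (⟨c, d⟩ : ℤ√(-1))
  · -- both coordinates of `b₂` odd
    rw [two_dvd_norm_iff] at hN
    change (2 ∣ c ↔ 2 ∣ d) at hN
    have hc1 : ¬ 2 ∣ c := fun h' ↦ hb₂odd ⟨h', hN.mp h'⟩
    have hd1 : ¬ 2 ∣ d := fun h' ↦ hb₂odd ⟨hN.mpr h', h'⟩
    refine ⟨by rcases abs_cases f with ⟨h', _⟩ | ⟨h', _⟩ <;> omega, ?_⟩
    have hAB : ¬(2 * |((⟨e, f⟩ : ℤ√(-1)) * star ⟨c, d⟩).re| = Zsqrtd.norm ⟨c, d⟩ ∧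
        2 * |((⟨e, f⟩ : ℤ√(-1)) * star ⟨c, d⟩).im| = Zsqrtd.norm ⟨c, d⟩) :=
      fun h' ↦ hr₂ (mem_digitSet_of_tie_tie hb₂C.ne_zero hb₂ h'.1 h'.2)
    have h2 := hG₂.two_mul_supNorm_lt (by change c ≠ 0; omega) (by change d ≠ 0; omega) hAB
    rwa [hr₂C.supNorm_eq, hb₂C.oneNorm_eq] at h2
  · have h' := hG₂.oneNorm_lt_of_odd_norm hN
    rwa [hr₂C.oneNorm_eq, hb₂C.supNorm_eq, hr₂C.supNorm_eq, hb₂C.oneNorm_eq] at h'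

/-- Corollary 3.3 for `φ`: `φ(r) ≥ φ(b)`, `r ≠ 0` a Gauss remainder modulo `b ≠ 0` ⇒ `ℓ1(r) < ℓ∞(b)` and
`2ℓ∞(r) < ℓ1(b)`. [cite: Graves2025, Cor. 3.3 (p. 4)] -/
theorem IsGaussRemainder.oneNorm_lt_supNorm_of_motzkinNorm_le {b r : ℤ√(-1)} (hG : IsGaussRemainder b r)
    (hb0 : b ≠ 0) (hr0 : r ≠ 0)
    (hφ : motzkinNorm forall_exists_not_mem_motzkinSet b ≤ motzkinNorm forall_exists_not_mem_motzkinSet r) :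
    oneNorm r < supNorm b ∧ 2 * supNorm r < oneNorm b := by
  obtain ⟨k, -, hb, hr⟩ := exists_motzkinNorm_eq_succ hG hb0 hr0 hφ
  exact hG.oneNorm_lt_supNorm hb0 hb hr

/-! ## §12 The example of §5 -/

/-- §5: «Observe that `v_{1+i}(4+i) = 0`, that `φ_{ℤ[i]}(2i) = 2 = φ_{ℤ[i]}(4+i)`, and that the Gauss remainder of
`9` and `4+i` is `2i`, so `2i` is not the pair's remainder for `φ_{ℤ[i]}`.»  Here: `9 = (2−i)(4+i) + 2i` with `2i`
a Gauss remainder, `2i, 4+i ∈ B₂ ∖ B₁`; Theorem 1.5 (condition (1): `u_{4+i} = 1`, `u_{2i} = −i`,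
`Im(u_b b) Im(u_r r) = 0`) adjusts it to `9 = 2(4+i) + (1 − 2i)` with `1 − 2i ∈ B₁`, i.e. `φ(1−2i) = 1 < 2`.
[cite: Graves2025, §5 (p. 5)] -/
theorem section5_example :
    (9 : ℤ√(-1)) = ⟨2, -1⟩ * ⟨4, 1⟩ + ⟨0, 2⟩ ∧ IsGaussRemainder ⟨4, 1⟩ ⟨0, 2⟩ ∧
      (⟨4, 1⟩ : ℤ√(-1)) ∈ digitSet 2 ∧ (⟨4, 1⟩ : ℤ√(-1)) ∉ digitSet 1 ∧
      (⟨0, 2⟩ : ℤ√(-1)) ∈ digitSet 2 ∧ (⟨0, 2⟩ : ℤ√(-1)) ∉ digitSet 1 ∧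
      normalUnit ⟨4, 1⟩ = 1 ∧ normalUnit ⟨0, 2⟩ = ⟨0, -1⟩ ∧
      (⟨0, 2⟩ - normalUnit ⟨4, 1⟩ * star (normalUnit ⟨0, 2⟩) * ⟨4, 1⟩ : ℤ√(-1)) = ⟨1, -2⟩ ∧
      (9 : ℤ√(-1)) = (⟨2, -1⟩ + normalUnit ⟨4, 1⟩ * star (normalUnit ⟨0, 2⟩)) * ⟨4, 1⟩ + ⟨1, -2⟩ ∧
      (⟨1, -2⟩ : ℤ√(-1)) ∈ digitSet 1 := by
  have hu1 : normalUnit ⟨4, 1⟩ = 1 := by decide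
  have hu2 : normalUnit (⟨0, 2⟩ : ℤ√(-1)) = ⟨0, -1⟩ := by decide
  have hv1 : twoVal (⟨4, 1⟩ : ℤ√(-1)) = 0 := (twoVal_eq_zero_iff (by decide)).mpr (by decide)
  have hv2 : twoVal (⟨0, 2⟩ : ℤ√(-1)) = 1 := twoVal_eq (by decide) (by decide) (by decide)
  have hv3 : twoVal (⟨1, -2⟩ : ℤ√(-1)) = 0 := (twoVal_eq_zero_iff (by decide)).mpr (by decide)
  have h9 : (9 : ℤ√(-1)) = ⟨9, 0⟩ := by decide
  refine ⟨by rw [h9]; decide, ⟨by decide, by decide⟩, ?_, ?_, ?_, ?_, hu1, hu2, ?_, ?_, ?_⟩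
  · rw [mem_digitSet_iff_supNorm_le (by decide), hv1]; decide
  · rw [not_mem_digitSet_iff_lt (by decide), hv1]; decide
  · rw [mem_digitSet_iff_supNorm_le (by decide), hv2]; decide
  · rw [not_mem_digitSet_iff_lt (by decide), hv2]; decide
  · rw [hu1, hu2]; decide
  · rw [h9, hu1, hu2]; decide
  · rw [mem_digitSet_iff_supNorm_le (by decide), hv3]; decide

end Literature.NumberTheory.QuadraticFields.GaussianDigits
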